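import Summits.NavierStokesRegularity.NavierStokesRegularity.Theses.SymmetryModuliCount
import Literature.Analysis.FluidPDE.PineauVicolRSS

/-!
# Sketch — crux-ideate round 1, ideator 3, crux `SymmetricLiouville` (stmt-NavierStokesRegularity-4053)

First lemmas of the two idea cards, stated over existing declarations (sorries allowed here;
nothing in this file is proposed to the tree).

* Card `screw-lattice-blowdown` (helical leaf R_h): `periodic_of_screw`,
  `typeI_constant_tendsto_zero_of_periodic`, `eq_zero_of_typeI_constant_tendsto_zero`,
  `periodic_liouville`.
* Card `stabiliser-at-infinity-decay` (leaves D_α incl. α = 0, and R_0 with swirl):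
  `decay_away_from_centre`, `decay_away_from_axis` (Lemma A), `hasTypeIDecay_of_spiral`,
  `rMulNorm_bounded_of_screw` (Lemma B), `axisymmetric_leaf`, `spiral_leaf_outside_window`.
* Frame: `symmetricLiouville_iff`, `symmetricLiouville_of_normal_forms`.
-/

noncomputable section

open Set Function MeasureTheory
open Literature.Analysis.FluidPDE

namespace Summit.NavierStokesRegularity.NavierStokesRegularity.Cruxes.SymmetricLiouville.Sketch

local notation "ℝ³" => EuclideanSpace ℝ (Fin 3)

/-- Membership in the class `𝒜_C`: verbatim the hypothesis block of `SymmetricLiouville`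
(smooth on `(-∞,0) × ℝ³`, divergence free, KNSS-mild with the in-tree `heatFlow`/`oseenKernel`,
temporal Type-I bound `HasTypeITimeDecay C`). -/
def InClass (C : ℝ) (u : ℝ → ℝ³ → ℝ³) : Prop :=
  ContDiffOn ℝ (⊤ : ℕ∞) (Function.uncurry u) (Set.Iio 0 ×ˢ Set.univ) ∧
  (∀ t < 0, VectorCalculus.IsDivFree (u t)) ∧
  (∀ s t : ℝ, s < t → t < 0 → ∀ x, u t x = heatFlow (u s) (t - s) x -
      ∫ τ in Set.Ioo s t, ∫ y, oseenKernel (t - τ) (x - y) (u τ y) (u τ y)) ∧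
  HasTypeITimeDecay C u

/-- `L_ξ u ≡ 0` for `ξ = (a, σ, A) ∈ sim(3)`: the infinitesimal symmetry of the crux, verbatim. -/
def Annihilates (a : ℝ³) (σ : ℝ) (A : ℝ³ →L[ℝ] ℝ³) (u : ℝ → ℝ³ → ℝ³) : Prop :=
  ∀ t < 0, ∀ x, fderiv ℝ (u t) x (a + σ • x + A x) + σ • u t x +
    (2 * σ * t) • timeDeriv u t x - A (u t x) = 0

/-- Frame check: the crux is literally "InClass ∧ Annihilates by a nonzero ξ ⇒ 0". -/
theorem symmetricLiouville_iff :
    Theses.SymmetryModuliCount.SymmetricLiouville ↔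
      ∀ (C : ℝ) (u : ℝ → ℝ³ → ℝ³), InClass C u →
        ∀ (a : ℝ³) (σ : ℝ) (A : ℝ³ →L[ℝ] ℝ³), (∀ x, inner ℝ (A x) x = 0) →
          ¬ (a = 0 ∧ σ = 0 ∧ A = 0) → Annihilates a σ A u → ∀ t < 0, ∀ x, u t x = 0 :=
  Iff.rfl

/-! ## Card 1 — screw-lattice blow-down (helical leaf) -/

/-- L1.1 (the lattice in the screw). Normal form of a screw generator: `σ = 0`, `A ≠ 0` skew,
`a ∈ ker A ∖ {0}` (axial drift = pitch). Integrating the flow of the affine field `a + Ax`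
(`Aa = 0`): `u(t, e^{θA}x + θa) = e^{θA} u(t,x)`; at `θ = 2π/|ω|` the rotation is the identity,
so `u(t, ·)` is invariant under the NONZERO translation `L = (2π/|ω|) a`. -/
theorem periodic_of_screw {C : ℝ} {u : ℝ → ℝ³ → ℝ³} (hu : InClass C u) {a : ℝ³}
    {A : ℝ³ →L[ℝ] ℝ³} (hA : ∀ x, inner ℝ (A x) x = 0) (hA0 : A ≠ 0) (ha : A a = 0)
    (ha0 : a ≠ 0) (hsym : Annihilates a 0 A u) :
    ∃ L : ℝ³, L ≠ 0 ∧ ∀ t < 0, ∀ x, u t (x + L) = u t x := by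
  sorry

/-- L1.2 (blow-down kills the period). If `u ∈ 𝒜_C` is invariant under one nonzero translation
`L`, then `√(-t) ‖u(t)‖_∞ → 0` as `t → -∞`: otherwise rescale `u_k(s,y) = λ_k u(λ_k² s, x_k + λ_k y)`,
`λ_k = √(-t_k) → ∞` (stays in `𝒜_C`, period `L/λ_k → 0`, `|∂u_k| ≤ C₁/(-s)` by
`knss2009_smoothing_holds`); a `C¹_loc` limit is in `𝒜_C`, independent of the `L`-direction and
nonzero at `(-1,0)` — contradicting the translation leaf `KNSS2009_typeI_rate_liouville_holds`. -/
theorem typeI_constant_tendsto_zero_of_periodic {C : ℝ} {u : ℝ → ℝ³ → ℝ³} (hu : InClass C u)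
    {L : ℝ³} (hL : L ≠ 0) (hper : ∀ t < 0, ∀ x, u t (x + L) = u t x) :
    ∀ ε > 0, ∃ T₀ < 0, ∀ t < T₀, ∀ x, Real.sqrt (-t) * ‖u t x‖ ≤ ε := by
  sorry

/-- L1.3 (ε-Liouville on an initial ray + forward uniqueness). For `u ∈ 𝒜_C`,
`u(t) = -∫_{-∞}^t e^{(t-τ)Δ}P∇·(u⊗u) dτ`; with `B(T₀) := sup_{t<T₀} √(-t)‖u(t)‖_∞` the Oseen bound
`‖K(τ,z)‖ ≤ C₀(τ+|z|²)^{-2}` (`exists_norm_oseenKernel_le`) gives `B(T₀) ≤ π K₀ B(T₀)²`, so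
`B(T₀) = 0` once `π K₀ B(T₀) < 1` (cf. `ChaeWolf.exists_eps_typeI_small_eq_zero`); then `u ≡ 0` on
`(-∞, T₀]` and uniqueness of bounded mild solutions propagates `0` forward to every `t < 0`. -/
theorem eq_zero_of_typeI_constant_tendsto_zero {C : ℝ} {u : ℝ → ℝ³ → ℝ³} (hu : InClass C u)
    (h : ∀ ε > 0, ∃ T₀ < 0, ∀ t < T₀, ∀ x, Real.sqrt (-t) * ‖u t x‖ ≤ ε) :
    ∀ t < 0, ∀ x, u t x = 0 := by
  sorry

/-- Card 1, conclusion: **discrete translations are free** — an element of `𝒜_C` invariant under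
one nonzero translation vanishes (hence the helical leaf, by `periodic_of_screw`). -/
theorem periodic_liouville {C : ℝ} {u : ℝ → ℝ³ → ℝ³} (hu : InClass C u) {L : ℝ³} (hL : L ≠ 0)
    (hper : ∀ t < 0, ∀ x, u t (x + L) = u t x) : ∀ t < 0, ∀ x, u t x = 0 :=
  eq_zero_of_typeI_constant_tendsto_zero hu (typeI_constant_tendsto_zero_of_periodic hu hL hper)

/-- Card 1 applied to the helical leaf in normal form. -/
theorem helical_leaf {C : ℝ} {u : ℝ → ℝ³ → ℝ³} (hu : InClass C u) {a : ℝ³} {A : ℝ³ →L[ℝ] ℝ³}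
    (hA : ∀ x, inner ℝ (A x) x = 0) (hA0 : A ≠ 0) (ha : A a = 0) (ha0 : a ≠ 0)
    (hsym : Annihilates a 0 A u) : ∀ t < 0, ∀ x, u t x = 0 := by
  obtain ⟨L, hL, hper⟩ := periodic_of_screw hu hA hA0 ha ha0 hsym
  exact periodic_liouville hu hL hper

/-! ## Card 2 — the stabiliser degenerates to a translation at infinity (Lemma A) and the
Oseen bootstrap (Lemma B) -/

/-- L2.A, spiral-scaling normal form (`a = 0`, `σ = 1`, `A` skew arbitrary, i.e. every RSS/SS
element about the space–time origin, every rate `α = ‖A‖`): **uniformly over `𝒜_C`**, the field is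
`o(1/√(-t))` away from the similarity centre. Proof: if `√(-t)|u_n(t_n,x_n)| ≥ ε` with
`|x_n|/√(-t_n) → ∞`, rescale to `t = -1` and translate `x_n` to `0`; the translated field is annihilated by
`L_{ξ_n}`, `ξ_n = ((I + A_n) x_n, 1, A_n)`, and `|(I + A_n)x_n| ≥ |x_n| → ∞`; dividing by it and passing
to a `C¹_loc` limit in `𝒜_C` (compactness from `knss2009_smoothing_holds` + dominated convergence in the
Oseen identity) yields a nonzero element annihilated by a pure translation — impossible by
`KNSS2009_typeI_rate_liouville_holds`. -/
theorem decay_away_from_centre (C : ℝ) :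
    ∀ ε > 0, ∃ ρ : ℝ, ∀ (u : ℝ → ℝ³ → ℝ³) (A : ℝ³ →L[ℝ] ℝ³), InClass C u →
      (∀ x, inner ℝ (A x) x = 0) → Annihilates 0 1 A u →
        ∀ t < 0, ∀ x, ρ * Real.sqrt (-t) ≤ ‖x‖ → Real.sqrt (-t) * ‖u t x‖ ≤ ε := by
  sorry

/-- L2.A, screw/rotation normal form (`σ = 0`, `A ≠ 0` skew, `a ∈ ker A`, any pitch): uniformly
over `𝒜_C`, the field is `o(1/√(-t))` away from the axis (`‖Ax‖ = |ω|·dist(x, axis)`, `‖A‖ = |ω|`).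
Same proof with horizontal translations (`|a + A c_n|² = |a|² + |A c_n|² → ∞`). -/
theorem decay_away_from_axis (C : ℝ) :
    ∀ ε > 0, ∃ ρ : ℝ, ∀ (u : ℝ → ℝ³ → ℝ³) (a : ℝ³) (A : ℝ³ →L[ℝ] ℝ³), InClass C u →
      (∀ x, inner ℝ (A x) x = 0) → A ≠ 0 → A a = 0 → Annihilates a 0 A u →
        ∀ t < 0, ∀ x, ρ * Real.sqrt (-t) * ‖A‖ ≤ ‖A x‖ → Real.sqrt (-t) * ‖u t x‖ ≤ ε := by
  sorry

/-- L2.B (Oseen bootstrap, spiral case): qualitative decay self-improves to the space–time Type-I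
bound (1.10) of Pineau–Vicol, with a constant depending on `C` only. From
`u(t) = -∫_{-∞}^t e^{(t-τ)Δ}P∇·(u⊗u)dτ`, `‖K(τ,z)‖ ≤ C₀(τ+|z|²)^{-2}` and self-similarity up to rotation,
`M(R) := sup{√(-t)|u| : |x| ≥ R√(-t)}` obeys `M(R) ≤ (K/R)(∫₀ᴿ M² + C') + K₁ M(R/4)²`; since `M → 0`
(Lemma A) a Riccati comparison gives `M(R) ≤ K(C)/R`. -/
theorem hasTypeIDecay_of_spiral (C : ℝ) :
    ∃ K : ℝ, ∀ (u : ℝ → ℝ³ → ℝ³) (A : ℝ³ →L[ℝ] ℝ³), InClass C u →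
      (∀ x, inner ℝ (A x) x = 0) → Annihilates 0 1 A u → HasTypeIDecay K u := by
  sorry

/-- L2.B (Oseen bootstrap, axis case): `dist(x,axis)·|u| ≤ K(C)` — the quantity `f = |x'||u|` of the
proof of KNSS Thm 6.2, here for ABSTRACT elements of `𝒜_C` (no far-field hypothesis (assumption2)),
which is what KNSS Thm 5.3 needs. -/
theorem rMulNorm_bounded_of_screw (C : ℝ) :
    ∃ K : ℝ, ∀ (u : ℝ → ℝ³ → ℝ³) (a : ℝ³) (A : ℝ³ →L[ℝ] ℝ³), InClass C u →
      (∀ x, inner ℝ (A x) x = 0) → A ≠ 0 → A a = 0 → Annihilates a 0 A u →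
        ∀ t < 0, ∀ x, ‖A x‖ * ‖u t x‖ ≤ K * ‖A‖ := by
  sorry

/-- Leaf R_0 (axisymmetric WITH swirl) for abstract `𝒜_C`: Lemma B-axis feeds the PROVED tree theorem
`KNSS2009_liouville_bound_C_over_r_holds` (KNSS Thm 5.3) on the windows `t ↦ u(t-δ)` (bounded there). -/
theorem axisymmetric_leaf {C : ℝ} {u : ℝ → ℝ³ → ℝ³} (hu : InClass C u)
    (haxi : ∀ t < 0, IsAxisymmetric (u t)) (hK : ∃ K : ℝ, ∀ t < 0, ∀ x, cylRadius x * ‖u t x‖ ≤ K) :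
    ∀ t < 0, ∀ x, u t x = 0 := by
  sorry

/-- Leaves D_α outside the Pineau–Vicol window, bounded profiles included: Lemma B puts every
spiral-scaling element of `𝒜_C` in the class (1.10) with `K = K(C)`; the named fact
`pineauVicol2026_rss_liouville` (PV 2026 Thm 1.4, hypothesis `hPV`) then gives `α₁(K), α₂(K)`;
`α = ‖A‖` is the rotation rate (`A = α·J` after aligning the axis). `A = 0` (Leray/Tsai) is `α = 0 < α₁`. -/
theorem spiral_leaf_outside_window (hPV : pineauVicol2026_rss_liouville) (C : ℝ) :
    ∃ α₁ α₂ : ℝ, 0 < α₁ ∧ 0 < α₂ ∧ ∀ (u : ℝ → ℝ³ → ℝ³) (A : ℝ³ →L[ℝ] ℝ³), InClass C u →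
      (∀ x, inner ℝ (A x) x = 0) → Annihilates 0 1 A u → (‖A‖ < α₁ ∨ α₂ < ‖A‖) →
        ∀ t < 0, ∀ x, u t x = 0 := by
  sorry

/-! ## Frame: conjugacy normal forms -/

/-- The crux from three normal-form leaves (conjugation by translations, rotations and scalings
preserves `𝒜_C` and transports `L_ξ`): translation leaf (tree, proved), screw leaf (any pitch `≥ 0`:
cards 1 + 2), spiral leaf (every skew `A`: card 2 outside the window; the window is PV Conj. 1.1). -/
theorem symmetricLiouville_of_normal_forms
    (hT : ∀ (C : ℝ) (u : ℝ → ℝ³ → ℝ³) (a : ℝ³), InClass C u → a ≠ 0 →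
      Annihilates a 0 0 u → ∀ t < 0, ∀ x, u t x = 0)
    (hR : ∀ (C : ℝ) (u : ℝ → ℝ³ → ℝ³) (a : ℝ³) (A : ℝ³ →L[ℝ] ℝ³), InClass C u →
      (∀ x, inner ℝ (A x) x = 0) → A ≠ 0 → A a = 0 → Annihilates a 0 A u → ∀ t < 0, ∀ x, u t x = 0)
    (hD : ∀ (C : ℝ) (u : ℝ → ℝ³ → ℝ³) (A : ℝ³ →L[ℝ] ℝ³), InClass C u →
      (∀ x, inner ℝ (A x) x = 0) → Annihilates 0 1 A u → ∀ t < 0, ∀ x, u t x = 0) :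
    Theses.SymmetryModuliCount.SymmetricLiouville := by
  sorry

end Summit.NavierStokesRegularity.NavierStokesRegularity.Cruxes.SymmetricLiouville.Sketch

end
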